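import Literature.NumberTheory.Rogawski1990.LocalStableClassesNonsplitKappaProduct      -- ★ (E4) p852562 (F0P2-p02): `finsum_mem_conjClassesIn_finKappaAt_mul_finKappaAt_out_eq_zero`; brings ★ `KappaCount` (`finKappaAt_eq_of_mk_eq_mk`), ★ `StableConjugacyU3` (`conjClassesIn`, `isStablyConj_iff`, `mk_mem_conjClassesIn_iff`)
import Literature.NumberTheory.Rogawski1990.FinExplicitTransferFactorNondegenerate        -- ★ `isUnit_eval_finCharpolyTwo_of_isLocalGRegular` (`G`-regularity read at the `U(1)`-slot)
import Literature.NumberTheory.Rogawski1990.CMLocalAPacketMembers                        -- ★ `Gqs`, `qsForm` (the (E8) sigsheet's carriers)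
import Literature.NumberTheory.Automorphic.LocalRegularOrbitClosed                       -- ★ `map_conjLocal_transpose_localForm`, `isUnit_det_localForm` (the local hermitian data of `Φ₃`)
import Mathlib.Topology.Algebra.ContinuousMonoidHom
import HarnessLib

/-!
# F0 · P3 — ROAD «ELL-INNER» (map owner LH6-p03 (g7)), brick (E4′) «CROSS, i-INDEXED»: the cross and diagonal κ-sums of Proposition 12.5.2 in the `(T, i)`
# letters of the (E8) assembly — `Σ_{i : Fin (n T)} κ(σ_u s, e_i s)·κ(σ_{u′} s, e_i s) = 0` (`u ≠ u′`) and `Σ_i κ(σ_u s, e_i s)² = n T`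

Cell `pub/hodgecm-mathlib`, crux H413 = `stmt-HodgeConjecture-24833` (lane `--supports … --as helper`), route HCCMUnconditional; seat LH6-p04 (g7), dealt BY NAME 2026-09-02T20:13:52Z by the
«ELL-INNER» map owner LH6-p03 (g7) (DEALS v2).  THEOREMS ONLY (no definition ∕ instance ∕ notation ∕ named fact ∕ `sorry`); ★-only imports.

WHAT.  The (E8) sigsheet of record (F0P3a-p06 (g23), `E8-Assembly.sigsheet.v1` 2491f5c6fae33558) takes two by-shape binders, :148 `hcross` and :150 `hdiag`, in the letters of the
`H`-Cartan system `(SH, n, γc, eT)` of ★ (A1′)-E ∕ (X2) and the slot maps `σ T u : ↥T → ↥T` of (E2)∕(E2b).  This file DISCHARGES both as standalone theorems whose conclusions are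
those letters token for token:
* §1 **`sum_finKappaAt_mul_self_eq_card`** (= `hdiag`): at a `G`-regular `s ∈ T ∈ SH` every `κ_v(σ_u s, e_i s)` is `±1` — `σ_u s` is `G`-regular (`hσreg`), so `χ_g(u)` is a unit
  (★ `isUnit_eval_finCharpolyTwo_of_isLocalGRegular`), and `σ_u s ↔ e_i s` (`hσR`), ★ `finKappaAt_eq_one_or_eq_neg_one_of_isUnit` — hence `Σ_i κ² = #Fin (n T) = n T`;
* §2 **`sum_finKappaAt_mul_finKappaAt_eq_zero`** (= `hcross`): ★ (E4) `finsum_mem_conjClassesIn_finKappaAt_mul_finKappaAt_out_eq_zero` (the sum of `κ(σ_u s, ·)κ(σ_{u′} s, ·)`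
  over the `G`-classes of the local STABLE class of a partner `b = e_{i₀} s` vanishes when the `U(1)`-eigenvalues of `σ_u s`, `σ_{u′} s` sit at DISTINCT slots `j ≠ j′` of a
  type-(1) eigenframe of `b`), read through the bijection **`i ↦ ⟦e_i s⟧ : Fin (n T) ≃ conjClassesIn ⟨b.val, b.2⟩`**: every `e_i s` is a partner of `σ_u s` (`hσR`), two partners
  of one element are stably conjugate (★ `Corresponds.isStablyConj_right`, ★ `mk_mem_conjClassesIn_iff`); distinct `i` give distinct classes (`hinj`); and every class of the
  stable class of `b` contains a partner of `s` (★ `isStablyConj_iff`, ★ `isLocalNormPair_of_conj_eq` at `heT i₀`), hence some `e_i s` (`hexh`) — so `∑ᶠ_{x ∈ 𝒪_st(b)}` is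
  `Σ_{i : Fin (n T)}` (`finsum_mem_range`, representatives by ★ `finKappaAt_eq_of_mk_eq_mk`).  The ONE new by-shape binder is the FRAME `hframe` (for `u ≠ u′`: a partner
  `e_{i₀} s`, an eigenframe `b P = P diag(d)` with `d` injective of norm-one entries, and slots `d j = γ₂(σ_u s)`, `d j′ = γ₂(σ_{u′} s)`, `j ≠ j′`) — ★ (E4)'s own
  `hP hu′i hu′1 hj hj′ hjj′`, discharged by (E2)∕(E2b) (type (1): the eigenframe + slot assignment; type (2): `cQ T = 1`, vacuous).
HONEST LABEL: count-neutral helper toward the (E8) assembly; `𝔇.Prop1252` stays a PRINTED consequent until its ★ rider; HC_CM is proved only modulo the 7 printed citations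
(2 remaining: hLiu418 = `stmt-HodgeConjecture-24832`, h413 = `stmt-HodgeConjecture-24833`) until rung 0 closes.

## References
* [Rogawski1990] J. D. Rogawski, *Automorphic Representations of Unitary Groups in Three Variables*, Ann. of Math. Stud. 123 (1990): §12.5 Prop. 12.5.2 (proof) p. 185
  («the sum over `δ` is zero unless the characters coincide»), §3.5 Prop. 3.5.2 (c) p. 29, §3.6 p. 31, §3.7 Prop. 3.7.1 p. 31, §4.3 (4.3.2) p. 43.
* [LanglandsShelstad1987] R. P. Langlands, D. Shelstad, *On the definition of transfer factors*, Math. Ann. 278 (1987), §1.3.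
-/

set_option autoImplicit false
-- the mandated namespace has the single-problem summit's repeated segment (`HodgeConjecture.HodgeConjecture`)
set_option linter.dupNamespace false

noncomputable section

open NumberField IsDedekindDomain Matrix
open Literature.NumberTheory.Automorphic Literature.NumberTheory.Automorphic.UnitaryGroup Literature.NumberTheory.Rogawski1990
open Literature.AlgebraicGeometry.ShimuraVarieties (unitaryGroup)
open scoped MatrixGroups

namespace Summit.HodgeConjecture.HodgeConjecture.Cruxes.H413.F0P3cStCharTSEllInnerCrossIndexed

section CM

variable (L : Type) [Field L] [NumberField L] [IsCMField L] (v : HeightOneSpectrum (𝓞 ↥(maximalRealSubfield L)))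

/-! ## §1 The diagonal: `Σ_i κ(σ_u s, e_i s)² = n T` -/

/-- **(E4′) DIAGONAL — the (E8) binder `hdiag`.**  For `T ∈ SH`, a `G`-regular `s ∈ T` and a slot `u`: `Σ_{i : Fin (n T)} κ_v(σ_u s, e_i s) · κ_v(σ_u s, e_i s) = n T` —
each `κ_v(σ_u s, e_i s) ∈ {±1}` since `σ_u s` is `G`-regular (`hσreg`; `χ_g(u)` a unit, ★ `isUnit_eval_finCharpolyTwo_of_isLocalGRegular`) and `σ_u s ↔ e_i s` (`hσR`)
(★ `finKappaAt_eq_one_or_eq_neg_one_of_isUnit`); `|𝔇(T∕F)|`-many classes (`n T = 4 ∕ 2` by type, not evaluated here). [cite: Rogawski1990, §12.5 Prop. 12.5.2 (proof) p. 185; §3.6 p. 31; §4.3 (4.3.2) p. 43] -/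
theorem sum_finKappaAt_mul_self_eq_card
    (SH : Finset (Subgroup ((UnitaryGroup.cmDatum L 2 (Matrix.of fun i j : Fin 2 => if i.val + j.val + 1 = 2 then (1 : L) else 0)).Local v × (UnitaryGroup.cmDatum L 1 (Matrix.of fun i j : Fin 1 => if i.val + j.val + 1 = 1 then (1 : L) else 0)).Local v)))
    (n : Subgroup ((UnitaryGroup.cmDatum L 2 (Matrix.of fun i j : Fin 2 => if i.val + j.val + 1 = 2 then (1 : L) else 0)).Local v × (UnitaryGroup.cmDatum L 1 (Matrix.of fun i j : Fin 1 => if i.val + j.val + 1 = 1 then (1 : L) else 0)).Local v) → ℕ)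
    (γc : (T : Subgroup ((UnitaryGroup.cmDatum L 2 (Matrix.of fun i j : Fin 2 => if i.val + j.val + 1 = 2 then (1 : L) else 0)).Local v × (UnitaryGroup.cmDatum L 1 (Matrix.of fun i j : Fin 1 => if i.val + j.val + 1 = 1 then (1 : L) else 0)).Local v)) → Fin (n T) → Gqs L v)
    (eT : (T : Subgroup ((UnitaryGroup.cmDatum L 2 (Matrix.of fun i j : Fin 2 => if i.val + j.val + 1 = 2 then (1 : L) else 0)).Local v × (UnitaryGroup.cmDatum L 1 (Matrix.of fun i j : Fin 1 => if i.val + j.val + 1 = 1 then (1 : L) else 0)).Local v)) → (i : Fin (n T)) → (↥T ≃ₜ* ↥(Subgroup.centralizer ({γc T i} : Set (Gqs L v)))))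
    (cQ : Subgroup ((UnitaryGroup.cmDatum L 2 (Matrix.of fun i j : Fin 2 => if i.val + j.val + 1 = 2 then (1 : L) else 0)).Local v × (UnitaryGroup.cmDatum L 1 (Matrix.of fun i j : Fin 1 => if i.val + j.val + 1 = 1 then (1 : L) else 0)).Local v) → ℕ)
    (σ : (T : Subgroup ((UnitaryGroup.cmDatum L 2 (Matrix.of fun i j : Fin 2 => if i.val + j.val + 1 = 2 then (1 : L) else 0)).Local v × (UnitaryGroup.cmDatum L 1 (Matrix.of fun i j : Fin 1 => if i.val + j.val + 1 = 1 then (1 : L) else 0)).Local v)) → Fin (cQ T) → (↥T → ↥T))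
    (hσreg : ∀ T ∈ SH, ∀ (u : Fin (cQ T)) (s : ↥T), IsLocalGRegular L v (s : ((UnitaryGroup.cmDatum L 2 (Matrix.of fun i j : Fin 2 => if i.val + j.val + 1 = 2 then (1 : L) else 0)).Local v × (UnitaryGroup.cmDatum L 1 (Matrix.of fun i j : Fin 1 => if i.val + j.val + 1 = 1 then (1 : L) else 0)).Local v)) →
      IsLocalGRegular L v (σ T u s : ((UnitaryGroup.cmDatum L 2 (Matrix.of fun i j : Fin 2 => if i.val + j.val + 1 = 2 then (1 : L) else 0)).Local v × (UnitaryGroup.cmDatum L 1 (Matrix.of fun i j : Fin 1 => if i.val + j.val + 1 = 1 then (1 : L) else 0)).Local v)))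
    (hσR : ∀ T ∈ SH, ∀ (u : Fin (cQ T)) (i : Fin (n T)) (s : ↥T), IsLocalGRegular L v (s : ((UnitaryGroup.cmDatum L 2 (Matrix.of fun i j : Fin 2 => if i.val + j.val + 1 = 2 then (1 : L) else 0)).Local v × (UnitaryGroup.cmDatum L 1 (Matrix.of fun i j : Fin 1 => if i.val + j.val + 1 = 1 then (1 : L) else 0)).Local v)) →
      IsLocalNormPair L (qsForm L) v (σ T u s).1 ((eT T i s : ↥(Subgroup.centralizer ({γc T i} : Set (Gqs L v)))) : Gqs L v)) :
    ∀ T ∈ SH, ∀ (s : ↥T), IsLocalGRegular L v (s : ((UnitaryGroup.cmDatum L 2 (Matrix.of fun i j : Fin 2 => if i.val + j.val + 1 = 2 then (1 : L) else 0)).Local v × (UnitaryGroup.cmDatum L 1 (Matrix.of fun i j : Fin 1 => if i.val + j.val + 1 = 1 then (1 : L) else 0)).Local v)) → ∀ u : Fin (cQ T),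
      ∑ i : Fin (n T), ((finKappaAt L v (qsForm L) (σ T u s).1 ((eT T i s : ↥(Subgroup.centralizer ({γc T i} : Set (Gqs L v)))) : Gqs L v) : ℤ) : ℂ) * ((finKappaAt L v (qsForm L) (σ T u s).1 ((eT T i s : ↥(Subgroup.centralizer ({γc T i} : Set (Gqs L v)))) : Gqs L v) : ℤ) : ℂ) = (n T : ℂ) := by
  intro T hT s hs u
  have hu : IsUnit ((finCharpolyTwo L v (σ T u s).1).eval (finGammaTwo L v (σ T u s).1)) :=
    isUnit_eval_finCharpolyTwo_of_isLocalGRegular L v (σ T u s).1 (hσreg T hT u s hs)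
  have h1 : ∀ i : Fin (n T), ((finKappaAt L v (qsForm L) (σ T u s).1 ((eT T i s : ↥(Subgroup.centralizer ({γc T i} : Set (Gqs L v)))) : Gqs L v) : ℤ) : ℂ) *
      ((finKappaAt L v (qsForm L) (σ T u s).1 ((eT T i s : ↥(Subgroup.centralizer ({γc T i} : Set (Gqs L v)))) : Gqs L v) : ℤ) : ℂ) = 1 := by
    intro i
    rcases finKappaAt_eq_one_or_eq_neg_one_of_isUnit L v (qsForm L) (σ T u s).1 _ (hσR T hT u i s hs) hu with h | h <;> rw [h] <;> norm_num
  rw [Finset.sum_congr rfl fun i _ => h1 i, Finset.sum_const, Finset.card_univ, Fintype.card_fin, nsmul_eq_mul, mul_one]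

/-! ## §2 The cross terms: `Σ_i κ(σ_u s, e_i s)·κ(σ_{u′} s, e_i s) = 0` for `u ≠ u′` -/

set_option maxHeartbeats 1600000 in
-- the local stable-class bookkeeping elaborates slowly on the CM carriers
/-- **(E4′) CROSS — the (E8) binder `hcross`.**  For `T ∈ SH`, a `G`-regular `s ∈ T` and slots `u ≠ u′`: `Σ_{i : Fin (n T)} κ_v(σ_u s, e_i s) · κ_v(σ_{u′} s, e_i s) = 0`.
★ (E4) `finsum_mem_conjClassesIn_finKappaAt_mul_finKappaAt_out_eq_zero` at the partner `b = e_{i₀} s` and the type-(1) frame of `hframe` (slots `j ≠ j′` carrying `γ₂(σ_u s)`,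
`γ₂(σ_{u′} s)`), read through the bijection `i ↦ ⟦e_i s⟧ : Fin (n T) ≃ 𝒪_st(b) ∕ conj` (module docstring: `hσR` + ★ `Corresponds.isStablyConj_right` for «lands», `hinj` for «injective»,
`heT` + ★ `isLocalNormPair_of_conj_eq` + `hexh` for «onto»).  «The sum over `δ ∈ 𝔇(T∕F)` of `κ(w₁(δ))κ(w₂(δ))` is zero unless `w₁w₂⁻¹ ∈ Ω_F(T, H)`» — distinct slots are distinct
`Ω_F(T, H)`-cosets. [cite: Rogawski1990, §12.5 Prop. 12.5.2 (proof) p. 185; §3.5 Prop. 3.5.2 (c) p. 29; §3.7 Prop. 3.7.1 p. 31; §4.3 (4.3.2) p. 43] [cite: LanglandsShelstad1987, §1.3] -/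
theorem sum_finKappaAt_mul_finKappaAt_eq_zero (hns : ∀ w : PlacesOver L v, IsCMField.complexConj L • w.1 = w.1)
    (SH : Finset (Subgroup ((UnitaryGroup.cmDatum L 2 (Matrix.of fun i j : Fin 2 => if i.val + j.val + 1 = 2 then (1 : L) else 0)).Local v × (UnitaryGroup.cmDatum L 1 (Matrix.of fun i j : Fin 1 => if i.val + j.val + 1 = 1 then (1 : L) else 0)).Local v)))
    (n : Subgroup ((UnitaryGroup.cmDatum L 2 (Matrix.of fun i j : Fin 2 => if i.val + j.val + 1 = 2 then (1 : L) else 0)).Local v × (UnitaryGroup.cmDatum L 1 (Matrix.of fun i j : Fin 1 => if i.val + j.val + 1 = 1 then (1 : L) else 0)).Local v) → ℕ)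
    (γc : (T : Subgroup ((UnitaryGroup.cmDatum L 2 (Matrix.of fun i j : Fin 2 => if i.val + j.val + 1 = 2 then (1 : L) else 0)).Local v × (UnitaryGroup.cmDatum L 1 (Matrix.of fun i j : Fin 1 => if i.val + j.val + 1 = 1 then (1 : L) else 0)).Local v)) → Fin (n T) → Gqs L v)
    (eT : (T : Subgroup ((UnitaryGroup.cmDatum L 2 (Matrix.of fun i j : Fin 2 => if i.val + j.val + 1 = 2 then (1 : L) else 0)).Local v × (UnitaryGroup.cmDatum L 1 (Matrix.of fun i j : Fin 1 => if i.val + j.val + 1 = 1 then (1 : L) else 0)).Local v)) → (i : Fin (n T)) → (↥T ≃ₜ* ↥(Subgroup.centralizer ({γc T i} : Set (Gqs L v)))))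
    (heT : ∀ T ∈ SH, ∀ (i : Fin (n T)) (s : ↥T), IsLocalNormPair L (qsForm L) v s.1 ((eT T i s : ↥(Subgroup.centralizer ({γc T i} : Set (Gqs L v)))) : Gqs L v))
    (hexh : ∀ T ∈ SH, ∀ (s : ↥T), IsLocalGRegular L v (s : ((UnitaryGroup.cmDatum L 2 (Matrix.of fun i j : Fin 2 => if i.val + j.val + 1 = 2 then (1 : L) else 0)).Local v × (UnitaryGroup.cmDatum L 1 (Matrix.of fun i j : Fin 1 => if i.val + j.val + 1 = 1 then (1 : L) else 0)).Local v)) →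
      ∀ γ' : Gqs L v, IsLocalNormPair L (qsForm L) v s.1 γ' → ∃ i : Fin (n T), IsConj ((eT T i s : ↥(Subgroup.centralizer ({γc T i} : Set (Gqs L v)))) : Gqs L v) γ')
    (hinj : ∀ T ∈ SH, ∀ (s : ↥T), IsLocalGRegular L v (s : ((UnitaryGroup.cmDatum L 2 (Matrix.of fun i j : Fin 2 => if i.val + j.val + 1 = 2 then (1 : L) else 0)).Local v × (UnitaryGroup.cmDatum L 1 (Matrix.of fun i j : Fin 1 => if i.val + j.val + 1 = 1 then (1 : L) else 0)).Local v)) →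
      ∀ i i' : Fin (n T), i ≠ i' → ¬ IsConj ((eT T i s : ↥(Subgroup.centralizer ({γc T i} : Set (Gqs L v)))) : Gqs L v) ((eT T i' s : ↥(Subgroup.centralizer ({γc T i'} : Set (Gqs L v)))) : Gqs L v))
    (cQ : Subgroup ((UnitaryGroup.cmDatum L 2 (Matrix.of fun i j : Fin 2 => if i.val + j.val + 1 = 2 then (1 : L) else 0)).Local v × (UnitaryGroup.cmDatum L 1 (Matrix.of fun i j : Fin 1 => if i.val + j.val + 1 = 1 then (1 : L) else 0)).Local v) → ℕ)
    (σ : (T : Subgroup ((UnitaryGroup.cmDatum L 2 (Matrix.of fun i j : Fin 2 => if i.val + j.val + 1 = 2 then (1 : L) else 0)).Local v × (UnitaryGroup.cmDatum L 1 (Matrix.of fun i j : Fin 1 => if i.val + j.val + 1 = 1 then (1 : L) else 0)).Local v)) → Fin (cQ T) → (↥T → ↥T))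
    (hσreg : ∀ T ∈ SH, ∀ (u : Fin (cQ T)) (s : ↥T), IsLocalGRegular L v (s : ((UnitaryGroup.cmDatum L 2 (Matrix.of fun i j : Fin 2 => if i.val + j.val + 1 = 2 then (1 : L) else 0)).Local v × (UnitaryGroup.cmDatum L 1 (Matrix.of fun i j : Fin 1 => if i.val + j.val + 1 = 1 then (1 : L) else 0)).Local v)) →
      IsLocalGRegular L v (σ T u s : ((UnitaryGroup.cmDatum L 2 (Matrix.of fun i j : Fin 2 => if i.val + j.val + 1 = 2 then (1 : L) else 0)).Local v × (UnitaryGroup.cmDatum L 1 (Matrix.of fun i j : Fin 1 => if i.val + j.val + 1 = 1 then (1 : L) else 0)).Local v)))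
    (hσR : ∀ T ∈ SH, ∀ (u : Fin (cQ T)) (i : Fin (n T)) (s : ↥T), IsLocalGRegular L v (s : ((UnitaryGroup.cmDatum L 2 (Matrix.of fun i j : Fin 2 => if i.val + j.val + 1 = 2 then (1 : L) else 0)).Local v × (UnitaryGroup.cmDatum L 1 (Matrix.of fun i j : Fin 1 => if i.val + j.val + 1 = 1 then (1 : L) else 0)).Local v)) →
      IsLocalNormPair L (qsForm L) v (σ T u s).1 ((eT T i s : ↥(Subgroup.centralizer ({γc T i} : Set (Gqs L v)))) : Gqs L v))
    -- the ONE new by-shape binder: a type-(1) eigenframe at a partner `e_{i₀} s` whose slots `j ≠ j′` carry the `U(1)`-eigenvalues of `σ_u s`, `σ_{u′} s` ((E2)∕(E2b)'s to discharge)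
    (hframe : ∀ T ∈ SH, ∀ (s : ↥T), IsLocalGRegular L v (s : ((UnitaryGroup.cmDatum L 2 (Matrix.of fun i j : Fin 2 => if i.val + j.val + 1 = 2 then (1 : L) else 0)).Local v × (UnitaryGroup.cmDatum L 1 (Matrix.of fun i j : Fin 1 => if i.val + j.val + 1 = 1 then (1 : L) else 0)).Local v)) →
      ∀ u u' : Fin (cQ T), u ≠ u' →
        ∃ (i₀ : Fin (n T)) (P : GL (Fin 3) (UnitaryGroup.LocalRing L v)) (d : Fin 3 → UnitaryGroup.LocalRing L v) (j j' : Fin 3),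
          (((eT T i₀ s : ↥(Subgroup.centralizer ({γc T i₀} : Set (Gqs L v)))) : Gqs L v).val.val : Matrix (Fin 3) (Fin 3) (UnitaryGroup.LocalRing L v)) * P.val = P.val * diagonal d ∧
          Function.Injective d ∧ (∀ k, UnitaryGroup.conjLocal L (IsCMField.complexConj L) v (d k) * d k = 1) ∧
          d j = finGammaTwo L v (σ T u s).1 ∧ d j' = finGammaTwo L v (σ T u' s).1 ∧ j ≠ j') :
    ∀ T ∈ SH, ∀ (s : ↥T), IsLocalGRegular L v (s : ((UnitaryGroup.cmDatum L 2 (Matrix.of fun i j : Fin 2 => if i.val + j.val + 1 = 2 then (1 : L) else 0)).Local v × (UnitaryGroup.cmDatum L 1 (Matrix.of fun i j : Fin 1 => if i.val + j.val + 1 = 1 then (1 : L) else 0)).Local v)) → ∀ u u' : Fin (cQ T), u ≠ u' →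
      ∑ i : Fin (n T), ((finKappaAt L v (qsForm L) (σ T u s).1 ((eT T i s : ↥(Subgroup.centralizer ({γc T i} : Set (Gqs L v)))) : Gqs L v) : ℤ) : ℂ) * ((finKappaAt L v (qsForm L) (σ T u' s).1 ((eT T i s : ↥(Subgroup.centralizer ({γc T i} : Set (Gqs L v)))) : Gqs L v) : ℤ) : ℂ) = 0 := by
  classical
  intro T hT s hs u u' huu'
  obtain ⟨i₀, P, d, j, j', hP, hdi, hd1, hj, hj', hjj'⟩ := hframe T hT s hs u u' huu'
  obtain ⟨w⟩ := (inferInstance : Nonempty (PlacesOver L v))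
  have hw : IsCMField.complexConj L • w.1 = w.1 := hns w
  -- the partner `b = e_{i₀} s` and the two `G`-regular endoscopic elements `a = σ_u s`, `a′ = σ_{u′} s`
  set b : Gqs L v := ((eT T i₀ s : ↥(Subgroup.centralizer ({γc T i₀} : Set (Gqs L v)))) : Gqs L v) with hb
  have ha : IsLocalNormPair L (qsForm L) v (σ T u s).1 b := hσR T hT u i₀ s hs
  have ha' : IsLocalNormPair L (qsForm L) v (σ T u' s).1 b := hσR T hT u' i₀ s hs
  have hu : IsUnit ((finCharpolyTwo L v (σ T u s).1).eval (finGammaTwo L v (σ T u s).1)) :=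
    isUnit_eval_finCharpolyTwo_of_isLocalGRegular L v (σ T u s).1 (hσreg T hT u s hs)
  have hu' : IsUnit ((finCharpolyTwo L v (σ T u' s).1).eval (finGammaTwo L v (σ T u' s).1)) :=
    isUnit_eval_finCharpolyTwo_of_isLocalGRegular L v (σ T u' s).1 (hσreg T hT u' s hs)
  -- the local hermitian data of `Φ₃`
  have hH := map_conjLocal_transpose_localForm L 3 (qsForm L) v (antidiagOne_isHermitian L 3)
  have hHd := isUnit_det_localForm L 3 (qsForm L) v (isUnit_antidiagOne_det L 3).ne_zero
  -- ★ (E4): the sum over the `G`-classes of the stable class of `b`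
  have key := finsum_mem_conjClassesIn_finKappaAt_mul_finKappaAt_out_eq_zero L v (qsForm L) (σ T u s).1 (σ T u' s).1 b w hw ha ha' hu hu'
    hH hHd hP hdi hd1 hj hj' hjj'
  -- ### the bijection `i ↦ ⟦e_i s⟧ : Fin (n T) ≃ conjClassesIn ⟨b.val, b.2⟩`
  set φ : Fin (n T) → ConjClasses ↥(unitaryGroup (UnitaryGroup.conjLocal L (IsCMField.complexConj L) v)
      ((UnitaryGroup.adelicForm L 3 (qsForm L)).map (UnitaryGroup.adeleToLocal L v))) :=
    fun i => ConjClasses.mk ⟨(((eT T i s : ↥(Subgroup.centralizer ({γc T i} : Set (Gqs L v)))) : Gqs L v)).val,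
      (((eT T i s : ↥(Subgroup.centralizer ({γc T i} : Set (Gqs L v)))) : Gqs L v)).2⟩ with hφ
  -- «lands»: two partners of `σ_u s` are stably conjugate
  have hmem : ∀ i : Fin (n T), φ i ∈ conjClassesIn (UnitaryGroup.conjLocal L (IsCMField.complexConj L) v)
      ((UnitaryGroup.adelicForm L 3 (qsForm L)).map (UnitaryGroup.adeleToLocal L v)) ⟨b.val, b.2⟩ := by
    intro i
    rw [hφ, mk_mem_conjClassesIn_iff]
    exact Corresponds.isStablyConj_right ((isLocalNormPair_iff L (qsForm L) v (σ T u s).1 b).1 ha)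
      ((isLocalNormPair_iff L (qsForm L) v (σ T u s).1 _).1 (hσR T hT u i s hs))
  -- «injective»: distinct `i` give non-conjugate `e_i s`
  have hφinj : Function.Injective φ := by
    intro i i' hii'
    by_contra hne
    apply hinj T hT s hs i i' hne
    obtain ⟨c, hc⟩ := isConj_iff.1 (ConjClasses.mk_eq_mk_iff_isConj.1 hii')
    exact isConj_iff.2 ⟨⟨c.val, c.2⟩, Subtype.ext (congrArg Subtype.val hc)⟩
  -- «onto»: every class of the stable class of `b` contains a partner of `s`, hence some `e_i s`
  have hrange : conjClassesIn (UnitaryGroup.conjLocal L (IsCMField.complexConj L) v)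
      ((UnitaryGroup.adelicForm L 3 (qsForm L)).map (UnitaryGroup.adeleToLocal L v)) ⟨b.val, b.2⟩ = Set.range φ := by
    ext x
    constructor
    · intro hx
      have hx' := hx
      rw [← show ConjClasses.mk (Quotient.out x) = x from Quotient.out_eq x] at hx'
      obtain ⟨g, hg⟩ := isStablyConj_iff.1 (mk_mem_conjClassesIn_iff.1 hx')
      have hpart : IsLocalNormPair L (qsForm L) v s.1 (⟨(Quotient.out x).val, (Quotient.out x).2⟩ : Gqs L v) :=
        isLocalNormPair_of_conj_eq L v (qsForm L) s.1 b ⟨(Quotient.out x).val, (Quotient.out x).2⟩ (heT T hT i₀ s) hg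
      obtain ⟨i, hi⟩ := hexh T hT s hs _ hpart
      refine ⟨i, ?_⟩
      rw [hφ, ← show ConjClasses.mk (Quotient.out x) = x from Quotient.out_eq x, ConjClasses.mk_eq_mk_iff_isConj]
      obtain ⟨c, hc⟩ := isConj_iff.1 hi
      exact isConj_iff.2 ⟨⟨c.val, c.2⟩, Subtype.ext (congrArg Subtype.val hc)⟩
    · rintro ⟨i, rfl⟩
      exact hmem i
  -- ### read ★ (E4)'s class sum as the `i`-sum
  rw [hrange, finsum_mem_range hφinj, finsum_eq_sum_of_fintype] at key
  have hterm : ∀ i : Fin (n T),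
      finKappaAt L v (qsForm L) (σ T u s).1 ⟨(Quotient.out (φ i)).val, (Quotient.out (φ i)).2⟩ *
          finKappaAt L v (qsForm L) (σ T u' s).1 ⟨(Quotient.out (φ i)).val, (Quotient.out (φ i)).2⟩ =
        finKappaAt L v (qsForm L) (σ T u s).1 ((eT T i s : ↥(Subgroup.centralizer ({γc T i} : Set (Gqs L v)))) : Gqs L v) *
          finKappaAt L v (qsForm L) (σ T u' s).1 ((eT T i s : ↥(Subgroup.centralizer ({γc T i} : Set (Gqs L v)))) : Gqs L v) := by
    intro i
    have hmk : ConjClasses.mk (⟨(((eT T i s : ↥(Subgroup.centralizer ({γc T i} : Set (Gqs L v)))) : Gqs L v)).val,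
        (((eT T i s : ↥(Subgroup.centralizer ({γc T i} : Set (Gqs L v)))) : Gqs L v)).2⟩ :
          ↥(unitaryGroup (UnitaryGroup.conjLocal L (IsCMField.complexConj L) v) ((UnitaryGroup.adelicForm L 3 (qsForm L)).map (UnitaryGroup.adeleToLocal L v)))) =
        ConjClasses.mk (Quotient.out (φ i)) := by
      rw [show ConjClasses.mk (Quotient.out (φ i)) = φ i from Quotient.out_eq (φ i)]
    rw [finKappaAt_eq_of_mk_eq_mk L v (qsForm L) (σ T u s).1 (hσR T hT u i s hs) hmk,
      finKappaAt_eq_of_mk_eq_mk L v (qsForm L) (σ T u' s).1 (hσR T hT u' i s hs) hmk]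
    rfl
  have key' : ∑ i : Fin (n T), finKappaAt L v (qsForm L) (σ T u s).1 ((eT T i s : ↥(Subgroup.centralizer ({γc T i} : Set (Gqs L v)))) : Gqs L v) *
      finKappaAt L v (qsForm L) (σ T u' s).1 ((eT T i s : ↥(Subgroup.centralizer ({γc T i} : Set (Gqs L v)))) : Gqs L v) = 0 := by
    rw [← key]
    exact Finset.sum_congr rfl fun i _ => (hterm i).symm
  have := congrArg (fun z : ℤ => (z : ℂ)) key'
  simpa [Int.cast_sum, Int.cast_mul] using this

end CM

end Summit.HodgeConjecture.HodgeConjecture.Cruxes.H413.F0P3cStCharTSEllInnerCrossIndexed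

end
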